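import Summits.Ventures.DiscreteObjects.Hadamard.ConferenceGraph333Order82
import Summits.Ventures.DiscreteObjects.Hadamard.ConferenceGraph333PGroupFixed

/-!
# Involutions of srg(333,166,82,83) commuting with elements of order `41` or `37`: fixed sets (kernel)

Framing: lottery ticket; floor = certified bounds/negative ranges.  Cell pub-namedobj (venture DiscreteObjects),
target (H) = `H(668)`, hadamard gen 31.  Local structure of the centralisers of the large primes, continuing gen 30's
`ConferenceGraph333Centralizer83` (an involution commuting with an element of order `83` fixes exactly one vertex):
* `order82_of_commuting` — `ρ⁴¹ = 1`, `τ² = 1`, `ρτ = τρ` ⇒ `(ρτ)⁸² = 1`, `(ρτ)⁴¹ = τ`, `(ρτ)² = ρ²`;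
* **`involution_centralizing_order41_fixed_one`** — an involution `τ` commuting with an automorphism `ρ` of order `41` fixes
  EXACTLY ONE vertex, and so does `ρτ` (the order-`82` cycle type `82⁴·2²·1¹` of `ConferenceGraph333Order82`, which rests on the
  gen-31 involution bound `f ≤ 149`: under the old bound `165` the type `82²·41⁴·2²·1` with `#Fix τ = 165` was not excluded);
* **`involution_centralizing_order37_fixed`** — an involution `τ` commuting with an automorphism `ρ` of order `37` fixes EXACTLY
  `37` vertices (`Fix τ` is `⟨ρ⟩`-invariant and `ρ` is fixed-point-free, so `37 ∣ #Fix τ` by the `p`-group congruence of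
  `ConferenceGraph333PGroupFixed`; with `#Fix τ ≡ 1 (mod 4)`, `#Fix τ ≤ 149`), and **`involution_centralizing_order37_fixed_orbit`** —
  these `37` vertices form ONE `⟨ρ⟩`-orbit.
So in a hypothetical Aut(srg(333,166,82,83)): `C(ρ₈₃) ∋ τ ⇒ #Fix τ = 1` (gen 30), `C(ρ₄₁) ∋ τ ⇒ #Fix τ = 1`, `C(ρ₃₇) ∋ τ ⇒ Fix τ` = one
`ρ₃₇`-orbit.  WORDS: structure of a HYPOTHETICAL object (nothing about H(668) is excluded); ours (PROVISIONAL).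
No `sorry`, no new definitions.
-/

namespace Summit.Ventures.DiscreteObjects.Hadamard

open Finset

section centralizers
variable {V : Type*} [Fintype V] [DecidableEq V]

omit [Fintype V] [DecidableEq V] in
/-- `σ = ρτ` has order dividing `82` when `ρ⁴¹ = 1`, `τ² = 1` and they commute: `σ⁸² = 1`, `σ⁴¹ = τ`, `σ² = ρ²`. -/
theorem order82_of_commuting (ρ τ : Equiv.Perm V) (hρ : ρ ^ 41 = 1) (hτ : τ ^ 2 = 1) (hc : ρ * τ = τ * ρ) :
    (ρ * τ) ^ 82 = 1 ∧ (ρ * τ) ^ 41 = τ ∧ (ρ * τ) ^ 2 = ρ ^ 2 := by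
  have hcomm : Commute ρ τ := hc
  refine ⟨?_, ?_, ?_⟩
  · rw [hcomm.mul_pow, show (82 : ℕ) = 41 * 2 by norm_num, pow_mul, hρ, one_pow, one_mul, pow_mul', hτ, one_pow]
  · rw [hcomm.mul_pow, hρ, one_mul, show (41 : ℕ) = 2 * 20 + 1 by norm_num, pow_succ, pow_mul, hτ, one_pow, one_mul]
  · rw [hcomm.mul_pow, hτ, mul_one]

/-- **An involution commuting with an automorphism of order `41` fixes exactly one vertex** (and so does their product,
an element of order `82`). -/
theorem involution_centralizing_order41_fixed_one (hV : Fintype.card V = 333) (A : Matrix V V ℤ)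
    (h01 : ∀ x y, A x y = 0 ∨ A x y = 1) (hsymm : ∀ x y, A y x = A x y) (hdiag : ∀ x, A x x = 0)
    (hk : ∀ x, ∑ y, A x y = 166) (hsrg : ∀ x y, ∑ z, A x z * A z y = 83 * (1 + (if x = y then 1 else 0)) - A x y)
    (ρ τ : Equiv.Perm V) (hρ : ρ ^ 41 = 1) (hρ1 : ρ ≠ 1) (hτ : τ ^ 2 = 1) (hτ1 : τ ≠ 1) (hc : ρ * τ = τ * ρ)
    (hAρ : ∀ x y, A (ρ x) (ρ y) = A x y) (hAτ : ∀ x y, A (τ x) (τ y) = A x y) :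
    (univ.filter fun x => τ x = x).card = 1 ∧ (univ.filter fun x => (ρ * τ) x = x).card = 1 := by
  obtain ⟨h82, h41, h2⟩ := order82_of_commuting ρ τ hρ hτ hc
  have hρ2 : ρ ^ 2 ≠ 1 := fun h => hρ1 (by
    have e : ρ ^ 41 = (ρ ^ 2) ^ 20 * ρ := by rw [← pow_mul, ← pow_succ]
    rw [h, one_pow, one_mul, hρ] at e
    exact e.symm)
  have hAσ : ∀ x y, A ((ρ * τ) x) ((ρ * τ) y) = A x y := fun x y => by
    rw [Equiv.Perm.mul_apply, Equiv.Perm.mul_apply, hAρ, hAτ]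
  obtain ⟨hf1, -, hf41⟩ := aut_order82_cycle_type hV A h01 hsymm hdiag hk hsrg (ρ * τ) h82 (by rw [h41]; exact hτ1)
    (by rw [h2]; exact hρ2) hAσ
  rw [h41] at hf41
  exact ⟨hf41, hf1⟩

/-- **An involution commuting with an automorphism of order `37` fixes exactly `37` vertices.** -/
theorem involution_centralizing_order37_fixed (hV : Fintype.card V = 333) (A : Matrix V V ℤ)
    (h01 : ∀ x y, A x y = 0 ∨ A x y = 1) (hsymm : ∀ x y, A y x = A x y) (hdiag : ∀ x, A x x = 0)
    (hk : ∀ x, ∑ y, A x y = 166) (hsrg : ∀ x y, ∑ z, A x z * A z y = 83 * (1 + (if x = y then 1 else 0)) - A x y)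
    (ρ τ : Equiv.Perm V) (hρ : ρ ^ 37 = 1) (hρ1 : ρ ≠ 1) (hτ : τ ^ 2 = 1) (hτ1 : τ ≠ 1) (hc : ρ * τ = τ * ρ)
    (hAρ : ∀ x y, A (ρ x) (ρ y) = A x y) (hAτ : ∀ x y, A (τ x) (τ y) = A x y) :
    (univ.filter fun x => τ x = x).card = 37 := by
  -- ρ is fixed-point-free (order-37 window)
  obtain ⟨-, -, -, -, -, -, -, w37, -, -⟩ :=
    aut_prime_windows_refined hV A h01 hsymm hdiag hk hsrg (by norm_num : Nat.Prime 37) (by norm_num) ρ hρ hρ1 hAρ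
  have hF0 : (univ.filter fun x => ρ x = x).card = 0 := w37 rfl
  -- Fix τ is ⟨ρ⟩-invariant
  have hcomm : Commute ρ τ := hc
  have hS : ∀ g ∈ Subgroup.zpowers ρ, ∀ y ∈ (univ.filter fun x => τ x = x), g y ∈ (univ.filter fun x => τ x = x) := by
    intro g hg y hy
    obtain ⟨k, rfl⟩ := Subgroup.mem_zpowers_iff.mp hg
    rw [Finset.mem_filter] at hy ⊢
    refine ⟨Finset.mem_univ _, ?_⟩
    have e := congrArg (fun g : Equiv.Perm V => g y) (hcomm.zpow_left k).eq
    simp only [Equiv.Perm.mul_apply] at e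
    rw [hy.2] at e
    exact e.symm
  haveI : Fact (Nat.Prime 37) := ⟨by norm_num⟩
  have hmod := pgroup_card_modEq_card_fixed (Subgroup.zpowers ρ)
    (isPGroup_zpowers_of_pow_eq_one ρ (p := 37) (e := 1) (by rw [pow_one]; exact hρ))
    (univ.filter fun x => ρ x = x) (mem_filter_fixed_iff_zpowers ρ) (univ.filter fun x => τ x = x) hS
  have hempty : (univ.filter fun x => ρ x = x) = ∅ := Finset.card_eq_zero.mp hF0
  rw [hempty, Finset.inter_empty, Finset.card_empty] at hmod
  have hdvd : 37 ∣ (univ.filter fun x => τ x = x).card := (Nat.modEq_zero_iff_dvd).mp hmod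
  -- involution window
  have hinv : ∀ x, τ (τ x) = x := fun x => by
    have := congrArg (fun g : Equiv.Perm V => g x) hτ
    simpa [pow_two] using this
  obtain ⟨wm, wl⟩ := involution_window_149 hV A h01 hsymm hdiag hk hsrg τ hinv hτ1 hAτ
  omega

/-- **… and these `37` fixed vertices form one `⟨ρ⟩`-orbit.** -/
theorem involution_centralizing_order37_fixed_orbit (hV : Fintype.card V = 333) (A : Matrix V V ℤ)
    (h01 : ∀ x y, A x y = 0 ∨ A x y = 1) (hsymm : ∀ x y, A y x = A x y) (hdiag : ∀ x, A x x = 0)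
    (hk : ∀ x, ∑ y, A x y = 166) (hsrg : ∀ x y, ∑ z, A x z * A z y = 83 * (1 + (if x = y then 1 else 0)) - A x y)
    (ρ τ : Equiv.Perm V) (hρ : ρ ^ 37 = 1) (hρ1 : ρ ≠ 1) (hτ : τ ^ 2 = 1) (hτ1 : τ ≠ 1) (hc : ρ * τ = τ * ρ)
    (hAρ : ∀ x y, A (ρ x) (ρ y) = A x y) (hAτ : ∀ x y, A (τ x) (τ y) = A x y) {y : V} (hy : τ y = y) :
    (univ.filter fun x => τ x = x) = (Finset.range 37).image (fun k => (ρ ^ k) y) := by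
  have h37 := involution_centralizing_order37_fixed hV A h01 hsymm hdiag hk hsrg ρ τ hρ hρ1 hτ hτ1 hc hAρ hAτ
  obtain ⟨-, -, -, -, -, -, -, w37, -, -⟩ :=
    aut_prime_windows_refined hV A h01 hsymm hdiag hk hsrg (by norm_num : Nat.Prime 37) (by norm_num) ρ hρ hρ1 hAρ
  have hF0 : (univ.filter fun x => ρ x = x).card = 0 := w37 rfl
  have hρy : ρ y ≠ y := fun h => by
    have : y ∈ (univ.filter fun x => ρ x = x) := Finset.mem_filter.mpr ⟨Finset.mem_univ _, h⟩
    rw [Finset.card_eq_zero.mp hF0] at this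
    exact Finset.notMem_empty y this
  have hcomm : Commute ρ τ := hc
  -- the orbit of y lies inside Fix τ
  have hsub : (Finset.range 37).image (fun k => (ρ ^ k) y) ⊆ (univ.filter fun x => τ x = x) := by
    intro z hz
    obtain ⟨k, -, rfl⟩ := Finset.mem_image.mp hz
    refine Finset.mem_filter.mpr ⟨Finset.mem_univ _, ?_⟩
    have e := congrArg (fun g : Equiv.Perm V => g y) (hcomm.pow_left k).eq
    simp only [Equiv.Perm.mul_apply] at e
    rw [hy] at e
    exact e.symm
  -- and has 37 elements
  have hcard : ((Finset.range 37).image (fun k => (ρ ^ k) y)).card = 37 := by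
    rw [Finset.card_image_of_injOn (orbP_injOn ρ (by norm_num) hρ y hρy), Finset.card_range]
  exact (Finset.eq_of_subset_of_card_le hsub (by rw [h37, hcard])).symm

end centralizers

end Summit.Ventures.DiscreteObjects.Hadamard
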